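import Summits.ABC.ABC.Theses.IsogenyGlueCongruence
import Literature.NumberTheory.EllipticCurves.MasserWustholzSurjectivity

/-!
# Sketch — crux-ideate stmt-ABC-13919 (`EllipticGluingPrimeBound`, U), ideator 5, round 2

Statements only (`def … : Prop`), elaborating over existing declarations; nothing is proved or
claimed proved here.  They accompany `NegativeNotes-ideator5.md` (obstruction-side findings) and are
offered to the standing disprover / support provers as PROVABLE SLICES of the free branch
`U_simple` (none of them is a line: each leaves the sporadic core untouched, see the notes).

* `AbelianNormalCentral` — kernel (K4): an abelian normal subgroup of `GL₂(𝔽_ℓ)`, `ℓ ≥ 5`, is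
  central (since `SL₂(𝔽_ℓ)` is perfect and `PSL₂(𝔽_ℓ)` simple).  Mathlib-provable.
* `CMTypePartnerBound` — slice (O1): a partner `A/ℚ` of CM TYPE (over some number field its
  endomorphism algebra contains a commutative semisimple `ℚ`-subalgebra of dimension `2·dim A`) that
  carries `W[ℓ]` `Γ_ℚ`-equivariantly, with `ρ̄_{W,ℓ}` surjective, has `ℓ ≤ 2·dim A + 1`.
  Proof sketch: the `ℓ`-adic image of `A` is virtually abelian; its image on the submodule `W[ℓ]` is
  all of `GL₂(𝔽_ℓ)`, whose abelian normal subgroups are central (K4), so `PGL₂(𝔽_ℓ)` is a quotient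
  of the finite group `Gal(L₀/ℚ)` acting faithfully on `End⁰(A_ℚ̄) = ∏ M_{mᵢ}(Fᵢ)`; a composition
  factor `PSL₂(𝔽_ℓ)` of a subgroup of `Aut(∏ M_{mᵢ}(Fᵢ))` forces `max mᵢ ≥ (ℓ-1)/2`
  (Feit–Tits / Landazuri–Seitz), or `#factors ≥ ℓ+1` (minimal permutation degree), or
  `[Fᵢ:ℚ] ≥ |PSL₂(𝔽_ℓ)|`; in all cases `dim A ≥ (ℓ-1)/2`.  The partner's height never enters;
  the surjectivity threshold `ℓ > c·max(1,h_F W)^γ` is the named fact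
  `masserWustholz_surjective_modEll`.
* `GoursatIndexDichotomy` — kernel (O3') behind the INDEX PRINCIPLE of `Disproof.lean` §3 (F9):
  for a subgroup `H ≤ PGL₂(𝔽_ℓ) × PGL₂(𝔽_ℓ)` with full second projection and any `φ`, either the
  "`φ`-twisted diagonal" has index `≥ |PSL₂(𝔽_ℓ)|` in `H`, or `H` is the graph of a homomorphism
  from its first projection (the sporadic case: the two projective representations agree on all of
  the group).  Arithmetic reading: a Weil-restriction partner `Res_{L/ℚ}(E₀ ⊗ ψ)` with `j(E₀) ∈ ℚ`
  costs `[L:ℚ] ≥ |PSL₂(𝔽_ℓ)|` unless `E₀` is projectively congruent to `W` over `ℚ` — WITHOUT any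
  hypothesis on the height or Galois image of `E₀` (only `ρ̄_{W,ℓ}` surjective is used).
-/

set_option linter.dupNamespace false

namespace Summit.ABC.ABC.Cruxes.EllipticGluingPrimeBound.SketchIdeator5

open Literature.AlgebraicGeometry.Motives
open CategoryTheory

/-- (K4) An abelian normal subgroup of `GL₂(𝔽_ℓ)` (`ℓ ≥ 5` prime) is contained in the centre.
Dickson / Jordan–Moore: the normal subgroups of `GL₂(𝔽_ℓ)` either contain `SL₂(𝔽_ℓ)` (non-abelian)
or are central. Pure Mathlib statement. -/
def AbelianNormalCentral : Prop :=
  ∀ (ℓ : ℕ) [Fact ℓ.Prime], 5 ≤ ℓ →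
    ∀ N : Subgroup (Matrix.GeneralLinearGroup (Fin 2) (ZMod ℓ)), N.Normal →
      (∀ x ∈ N, ∀ y ∈ N, x * y = y * x) →
        N ≤ Subgroup.center (Matrix.GeneralLinearGroup (Fin 2) (ZMod ℓ))

/-- (O1) CM-TYPE PARTNERS COST `dim ≥ (ℓ-1)/2`.  For an elliptic `W/ℚ` with SURJECTIVE mod-`ℓ`
representation (`ℓ ≥ 5`) and an abelian variety `A/ℚ` of CM type — over some number field `L` the
endomorphism algebra `End⁰(A_L)` contains a commutative `ℚ`-subalgebra of `ℚ`-dimension `2·dim A` —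
a `Γ_ℚ`-equivariant embedding `W[ℓ] ↪ A(ℚ̄)` forces `ℓ ≤ 2·dim A + 1`.  Height-free in BOTH
varieties; the only place `h_F(W)` enters a use of it is the surjectivity threshold
(`Literature.NumberTheory.EllipticCurves.masserWustholz_surjective_modEll`). -/
def CMTypePartnerBound : Prop :=
  ∀ (W : WeierstrassCurve ℚ) [W.IsElliptic] (A : AbelianVariety.{0} ℚ) (ℓ : ℕ), ℓ.Prime → 5 ≤ ℓ →
    W.HasSurjectiveModNGaloisRep ℓ →
    (∃ (L : Type) (_ : Field L) (_ : NumberField L) (_ : Algebra ℚ L)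
        (S : Subalgebra ℚ (AbelianVariety.endAlgebra (A.baseChange L))),
        (∀ x ∈ S, ∀ y ∈ S, x * y = y * x) ∧ Module.finrank ℚ S = 2 * A.dim) →
    (∃ ι : W.geomTorsion ℓ →+ A.geomPoints, Function.Injective ι ∧
        ∀ (σ : Field.absoluteGaloisGroup ℚ) (P : W.geomTorsion ℓ), ι (σ • P) = σ • ι P) →
    ℓ ≤ 2 * A.dim + 1

/-- `PGL₂(𝔽_ℓ)` as the quotient of `GL₂(ℤ/ℓ)` by its centre. -/
abbrev PGL2 (ℓ : ℕ) : Type :=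
  Matrix.GeneralLinearGroup (Fin 2) (ZMod ℓ) ⧸
    Subgroup.center (Matrix.GeneralLinearGroup (Fin 2) (ZMod ℓ))

/-- The `φ`-twisted diagonal `{(a, φ a φ⁻¹)}` of `PGL₂(𝔽_ℓ) × PGL₂(𝔽_ℓ)`. -/
def twistedDiagonal (ℓ : ℕ) (φ : PGL2 ℓ) : Subgroup (PGL2 ℓ × PGL2 ℓ) :=
  ((MonoidHom.id (PGL2 ℓ)).prod (MulAut.conj φ).toMonoidHom).range

/-- (O3') GOURSAT INDEX DICHOTOMY (the group theory behind the INDEX PRINCIPLE, Disproof §3 F9).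
Let `ℓ ≥ 5` and `H ≤ PGL₂(𝔽_ℓ) × PGL₂(𝔽_ℓ)` with full SECOND projection (the `W`-side, surjective
`ρ̄_{W,ℓ}`).  Then either, for every `φ`, the stabiliser `H ∩ {(a, φaφ⁻¹)}` has index at least
`|PSL₂(𝔽_ℓ)| = ℓ(ℓ²-1)/2` in `H` (the orbit of any identification of the two projective structures
has at least that size: COST `≥ ℓ(ℓ²-1)/2`), or `H` is the GRAPH of a homomorphism defined on its
first projection (the two projective representations agree on the whole group: the SPORADIC case).
Proof: Goursat's lemma with `N₂ = {b : (1,b) ∈ H}` normal in `PGL₂(𝔽_ℓ)`, hence `⊇ PSL₂(𝔽_ℓ)` or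
trivial (simplicity of `PSL₂(𝔽_ℓ)`, `ℓ ≥ 5`); in the first case `{1} × N₂ ≤ H` meets every twisted
diagonal trivially.  No hypothesis on the first projection. -/
def GoursatIndexDichotomy : Prop :=
  ∀ (ℓ : ℕ) [Fact ℓ.Prime], 5 ≤ ℓ →
    ∀ H : Subgroup (PGL2 ℓ × PGL2 ℓ), Subgroup.map (MonoidHom.snd (PGL2 ℓ) (PGL2 ℓ)) H = ⊤ →
      (∀ φ : PGL2 ℓ, ℓ * (ℓ ^ 2 - 1) / 2 ≤ (H ⊓ twistedDiagonal ℓ φ).relIndex H) ∨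
      (∃ ψ : Subgroup.map (MonoidHom.fst (PGL2 ℓ) (PGL2 ℓ)) H →* PGL2 ℓ,
        ∀ x : PGL2 ℓ × PGL2 ℓ, x ∈ H ↔
          ∃ hx : x.1 ∈ Subgroup.map (MonoidHom.fst (PGL2 ℓ) (PGL2 ℓ)) H, x.2 = ψ ⟨x.1, hx⟩)

end Summit.ABC.ABC.Cruxes.EllipticGluingPrimeBound.SketchIdeator5
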